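import Summits.KontsevichZagierPeriods.KontsevichZagierPeriods.Theorems.RootDecompWalshStrataPolarChart04

/-!
# The elliptic-polar chart, part 5/5: boundary sections in HEIGHT coordinates

Declarations `isSemialgebraicFunOn_abs` … `Conic.hasDerivAt_hix` of the farm-checked gen-7 file `PolarChart.lean`: the height
reparametrisation `t = Y/X(Y)` of a boundary-section term of `InBaker.of_psector` (`InBaker.psection_height`, rule (2) in one
variable via the landed `InBaker.of_cov₁'`): the factor `1/W(t) = X²/(κ₀X² + κ₁Y²)` absorbs the `X²` of `dt = (X − YX′)/X² dY`, so the
height integrand `pheight = (γ/(3a))·h(√(κ₀X² + κ₁Y²))·|X − YX′|/(κ₀X² + κ₁Y²)` has no pole at the asymptotic directions of a conic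
wall (the slope parametrisation does); its semialgebraicity; the injectivity input (`injOn_pΨ`, `height_inj_of_norm`); and the
wall-as-graph-over-the-height-axis toolkit: `Conic.transpose`, `Conic.pxy_lox/pxy_hix`, `Conic.hasDerivAt_Bx/Dx/lox/hix`.
See the module docstring of `RootDecompWalshStrataPolarChart01` (part 1). [KontsevichZagier2001 §1.2 rule (2); BCR1998 §2.2; this node gen 7]
-/

noncomputable section

open Set MeasureTheory MvPolynomial Literature.NumberTheory.Transcendental
open Literature.ModelTheory.ExponentialFields (IsSemialgebraic isSemialgebraic_univ)

namespace Summit.KontsevichZagierPeriods.RootDecompWalshStrata.ConicDescent.BallCube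

variable {κ₀ κ₁ : ℚ}

/-! #### 32.10 Boundary sections in HEIGHT coordinates (the cure of the asymptotic-direction disease, NODE (7′)) -/

/-- `|F|` is semialgebraic (`|F| = √(F·F)`). [BCR1998 §2.2] -/
theorem isSemialgebraicFunOn_abs {m : ℕ} {T : Set (Fin m → ℝ)} {F : (Fin m → ℝ) → ℝ}
    (hF : IsSemialgebraicFunOn ℚ T F) : IsSemialgebraicFunOn ℚ T fun v => |F v| :=
  (IsSemialgebraicFunOn.sqrt_holds (IsSemialgebraicFunOn.mul_holds hF hF)).congr fun v _ => by
    simp only [Pi.mul_apply, Real.sqrt_mul_self_eq_abs]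

/-- The derivative of the slope `Y ↦ Y/X(Y)` along a graph `X = X(Y)`. [calculus] -/
theorem hasDerivAt_slope {X : ℝ → ℝ} {X'₀ y : ℝ} (hX : HasDerivAt X X'₀ y) (hne : X y ≠ 0) :
    HasDerivAt (fun s : ℝ => s / X s) ((1 * X y - y * X'₀) / X y ^ 2) y :=
  (hasDerivAt_id y).div hX hne

/-- The height integrand `(γ/(3a))·h(√(κ₀X² + κ₁Y²))·|X − Y X′|/(κ₀X² + κ₁Y²)` of a section over the graph
`X = X(Y)`. [this node] -/
def pheight (κ₀ κ₁ γ a c : ℚ) (X X' : ℝ → ℝ) (v : Fin 1 → ℝ) : ℝ :=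
  (γ : ℝ) / (3 * a) * ph a c (√(κ₀ * X (v 0) ^ 2 + κ₁ * v 0 ^ 2)) * |X (v 0) - v 0 * X' (v 0)| /
    (κ₀ * X (v 0) ^ 2 + κ₁ * v 0 ^ 2)

/-- The height integrand is `ℚ`-semialgebraic when `X`, `X′` are. [BCR1998 §2.2] -/
theorem isSemialgebraicFunOn_pheight (hκ : 0 < κ₀ ∧ 0 ≤ κ₁) (γ a c : ℚ) {T₀ : Set (Fin 1 → ℝ)}
    (hT₀ : IsSemialgebraic ℚ T₀) {X X' : ℝ → ℝ} (hXsa : IsSemialgebraicFunOn ℚ T₀ fun v => X (v 0))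
    (hX'sa : IsSemialgebraicFunOn ℚ T₀ fun v => X' (v 0)) (hXpos : ∀ v ∈ T₀, 0 < X (v 0)) :
    IsSemialgebraicFunOn ℚ T₀ (pheight κ₀ κ₁ γ a c X X') := by
  have h0 := isSemialgebraicFunOn_apply hT₀ (0 : Fin 1)
  have hE : IsSemialgebraicFunOn ℚ T₀ fun v => (κ₀ : ℝ) * X (v 0) ^ 2 + κ₁ * v 0 ^ 2 :=
    (((isSemialgebraicFunOn_ratCast hT₀ κ₀).mul_holds (hXsa.mul_holds hXsa)).add_holds
      ((isSemialgebraicFunOn_ratCast hT₀ κ₁).mul_holds (h0.mul_holds h0))).congr fun v _ => by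
      simp only [Pi.add_apply, Pi.mul_apply]; ring
  have hEpos : ∀ v ∈ T₀, 0 < (κ₀ : ℝ) * X (v 0) ^ 2 + κ₁ * v 0 ^ 2 := fun v hv => by
    have h1 : (0 : ℝ) < κ₀ := by exact_mod_cast hκ.1
    have h2 : (0 : ℝ) ≤ κ₁ := by exact_mod_cast hκ.2
    nlinarith [pow_pos (hXpos v hv) 2, mul_nonneg h2 (sq_nonneg (v 0)), mul_pos h1 (pow_pos (hXpos v hv) 2)]
  have hS : IsSemialgebraicFunOn ℚ T₀ fun v => √((κ₀ : ℝ) * X (v 0) ^ 2 + κ₁ * v 0 ^ 2) :=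
    IsSemialgebraicFunOn.sqrt_holds hE
  have hU : IsSemialgebraicFunOn ℚ T₀ fun v =>
      (a : ℝ) * √((κ₀ : ℝ) * X (v 0) ^ 2 + κ₁ * v 0 ^ 2) ^ 2 + c :=
    (((isSemialgebraicFunOn_ratCast hT₀ a).mul_holds (hS.mul_holds hS)).add_holds
      (isSemialgebraicFunOn_ratCast hT₀ c)).congr fun v _ => by
      simp only [Pi.add_apply, Pi.mul_apply]; ring
  have hph : IsSemialgebraicFunOn ℚ T₀ fun v =>
      ph a c (√((κ₀ : ℝ) * X (v 0) ^ 2 + κ₁ * v 0 ^ 2)) :=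
    (hU.mul_holds (IsSemialgebraicFunOn.sqrt_holds hU)).congr fun v _ => by
      simp only [Pi.mul_apply, ph]
  have habs : IsSemialgebraicFunOn ℚ T₀ fun v => |X (v 0) - v 0 * X' (v 0)| :=
    isSemialgebraicFunOn_abs ((hXsa.sub_holds (h0.mul_holds hX'sa)).congr fun v _ => by
      simp only [Pi.sub_apply, Pi.mul_apply])
  exact ((((isSemialgebraicFunOn_ratCast hT₀ (γ / (3 * a))).mul_holds hph).mul_holds habs).div hE
    fun v hv => (hEpos v hv).ne').congr fun v _ => by
    simp only [Pi.mul_apply, pheight]; push_cast; ring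

/-- **HEIGHT REPARAMETRISATION of a boundary-section term of `InBaker.of_psector`** (rule (2) in one variable,
`t = Y/X(Y)`): if the chart carries the graph of `ζ` over `S` into the graph `X = X(Y) > 0` over a height set
`T₀` (`ζ(Y/X(Y)) = √(κ₀X(Y)² + κ₁Y²)`, i.e. `Φ(t, ζ t) = (X(Y), Y)`), the slope being injective on `T₀` and
covering `S`, then `[S, P(t, ζ t)]` is in the Baker sector as soon as the height integral
`[{Y ∈ T₀ | Y/X(Y) ∈ S}, (γ/(3a))·h(√(κ₀X² + κ₁Y²))·|X − YX′|/(κ₀X² + κ₁Y²)]` is — the factor `1/W(t) = X²/(κ₀X² + κ₁Y²)`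
has absorbed the `X²` of `dt = (X − YX′)/X² dY`, so no pole is left at the asymptotic directions of a conic
wall; on a wall of the adapted family `a(κ₀X² + κ₁Y²) + c` is the square of an affine form, so `h(√…) = |affine|³`.
[KontsevichZagier2001 §1.2 rule (2); this node] -/
theorem InBaker.psection_height (hκ : 0 < κ₀ ∧ 0 ≤ κ₁) (γ a c : ℚ) {S T₀ : Set (Fin 1 → ℝ)}
    (hT₀ : IsSemialgebraic ℚ T₀) (X X' : ℝ → ℝ) (hXsa : IsSemialgebraicFunOn ℚ T₀ fun v => X (v 0))
    (hX'sa : IsSemialgebraicFunOn ℚ T₀ fun v => X' (v 0)) (hXpos : ∀ v ∈ T₀, 0 < X (v 0))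
    (hder : ∀ v ∈ T₀, HasDerivAt X (X' (v 0)) (v 0))
    (hinj : ∀ u ∈ T₀, ∀ v ∈ T₀, u 0 / X (u 0) = v 0 / X (v 0) → u 0 = v 0)
    (hsurj : ∀ x ∈ S, ∃ v ∈ T₀, v 0 / X (v 0) = x 0) (ζ : (Fin 1 → ℝ) → ℝ)
    (hζ : ∀ v ∈ T₀, lift₁ (fun s => s / X s) v ∈ S →
      ζ (lift₁ (fun s => s / X s) v) = √(κ₀ * X (v 0) ^ 2 + κ₁ * v 0 ^ 2))
    (r₁ : KZ.IntegralRep 1) (hr₁ : r₁.domain = S)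
    (hr₁i : EqOn r₁.integrand (fun x => ppot κ₀ κ₁ γ a c (Fin.snoc x (ζ x))) S)
    (h : ∀ r : KZ.IntegralRep 1, r.domain = {v | v ∈ T₀ ∧ lift₁ (fun s => s / X s) v ∈ S} →
      r.integrand = pheight κ₀ κ₁ γ a c X X' → InBaker (KZ.of r)) :
    InBaker (KZ.of r₁) := by
  subst hr₁
  have hg : IsSemialgebraicFunOn ℚ T₀ fun v => v 0 / X (v 0) :=
    (isSemialgebraicFunOn_apply hT₀ (0 : Fin 1)).div hXsa fun v hv => (hXpos v hv).ne'
  refine InBaker.of_cov₁' r₁ hT₀ (fun s => s / X s) (fun s => (1 * X s - s * X' s) / X s ^ 2) hg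
    (fun v hv => hasDerivAt_slope (hder v hv) (hXpos v hv).ne') hinj hsurj
    (pheight κ₀ κ₁ γ a c X X') (isSemialgebraicFunOn_pheight hκ γ a c hT₀ hXsa hX'sa hXpos)
    (fun v hv hvd => ?_) h
  have hX0 : 0 < X (v 0) := hXpos v hv
  have h1 : (0 : ℝ) < κ₀ := by exact_mod_cast hκ.1
  have h2 : (0 : ℝ) ≤ κ₁ := by exact_mod_cast hκ.2
  have hE : 0 < (κ₀ : ℝ) * X (v 0) ^ 2 + κ₁ * v 0 ^ 2 := by
    nlinarith [mul_nonneg h2 (sq_nonneg (v 0)), mul_pos h1 (pow_pos hX0 2)]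
  have e0 : (Fin.snoc (lift₁ (fun s => s / X s) v) (ζ (lift₁ (fun s => s / X s) v)) : Fin 2 → ℝ) 0 =
      v 0 / X (v 0) := by
    have : (0 : Fin 2) = Fin.castSucc (0 : Fin 1) := rfl
    rw [this, Fin.snoc_castSucc]
    rfl
  have e1 : (Fin.snoc (lift₁ (fun s => s / X s) v) (ζ (lift₁ (fun s => s / X s) v)) : Fin 2 → ℝ) 1 =
      √(κ₀ * X (v 0) ^ 2 + κ₁ * v 0 ^ 2) := by
    have : (1 : Fin 2) = Fin.last 1 := rfl
    rw [this, Fin.snoc_last, hζ v hv hvd]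
  rw [hr₁i hvd]
  beta_reduce
  rw [ppot_eq, e0, e1, ppotFib, pheight, one_mul, abs_div, abs_of_pos (pow_pos hX0 2)]
  have hW : (κ₀ : ℝ) + κ₁ * (v 0 / X (v 0)) ^ 2 = (κ₀ * X (v 0) ^ 2 + κ₁ * v 0 ^ 2) / X (v 0) ^ 2 := by
    field_simp
  rw [hW]
  field_simp

/-- The inverse chart `Ψ` is injective on `{X > 0}`: two points on the same open ray from the centre with the same
`κ`-norm coincide (the injectivity input `hinj` of `InBaker.psection_height` on the set of heights whose branch point IS
the section point). [this node] -/
theorem injOn_pΨ (hκ : 0 < κ₀ ∧ 0 ≤ κ₁) : InjOn (pΨ κ₀ κ₁) {w : Fin 2 → ℝ | 0 < w 0} := by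
  intro w₁ h₁ w₂ h₂ h
  rw [← pΦ_pΨ hκ (w := w₁) h₁, ← pΦ_pΨ hκ (w := w₂) h₂, h]

/-- The slope determines the height on a graph `X = X(Y) > 0` once the `κ`-norm is prescribed by a function of the
slope (the form in which `hinj` is discharged). [this node] -/
theorem height_inj_of_norm (hκ : 0 < κ₀ ∧ 0 ≤ κ₁) {X : ℝ → ℝ} {ζ : ℝ → ℝ} {y₁ y₂ : ℝ} (h₁ : 0 < X y₁)
    (h₂ : 0 < X y₂) (hn₁ : ζ (y₁ / X y₁) = √(κ₀ * X y₁ ^ 2 + κ₁ * y₁ ^ 2))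
    (hn₂ : ζ (y₂ / X y₂) = √(κ₀ * X y₂ ^ 2 + κ₁ * y₂ ^ 2)) (ht : y₁ / X y₁ = y₂ / X y₂) : y₁ = y₂ := by
  have hΨ : pΨ κ₀ κ₁ ![X y₁, y₁] = pΨ κ₀ κ₁ ![X y₂, y₂] := by
    funext j
    fin_cases j
    · simpa [pΨ] using ht
    · simp only [pΨ, Fin.mk_one, Matrix.cons_val_one, Matrix.cons_val_fin_one, Matrix.cons_val_zero]
      rw [← hn₁, ← hn₂, ht]
  have := injOn_pΨ hκ (show (0 : ℝ) < (![X y₁, y₁] : Fin 2 → ℝ) 0 by simpa using h₁)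
    (show (0 : ℝ) < (![X y₂, y₂] : Fin 2 → ℝ) 0 by simpa using h₂) hΨ
  simpa using congrFun this 1

/-- The TRANSPOSED conic: `F.transpose.pxy y x = F.pxy x y` (the wall as a graph over the height axis). [this node] -/
def _root_.Summit.KontsevichZagierPeriods.RootDecompWalshStrata.ConicDescent.Conic.transpose (F : Conic) : Conic := ⟨F.c2, F.c1, F.b1, F.c0, F.b0, F.A⟩

/-- Auxiliary step `transpose_pxy`. [bookkeeping] -/
theorem _root_.Summit.KontsevichZagierPeriods.RootDecompWalshStrata.ConicDescent.Conic.transpose_pxy (F : Conic) (x y : ℝ) :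
    F.transpose.pxy y x = F.pxy x y := by
  simp only [Conic.transpose, Conic.pxy, Conic.Bx, Conic.Cx]
  ring

/-- The roots ARE roots (`A ≠ 0`, `D ≥ 0`). [folklore] -/
theorem _root_.Summit.KontsevichZagierPeriods.RootDecompWalshStrata.ConicDescent.Conic.pxy_lox (K : Conic) (hA : K.A ≠ 0) {x : ℝ} (hD : 0 ≤ K.Dx x) :
    K.pxy x (K.lox x) = 0 := by
  have hA' : (K.A : ℝ) ≠ 0 := by exact_mod_cast hA
  have hk := K.key x (K.lox x)
  have h2 : 2 * (K.A : ℝ) * K.lox x + K.Bx x = √(K.Dx x) := by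
    rw [Conic.lox]; field_simp; ring
  rw [h2, Real.sq_sqrt hD, sub_self] at hk
  have h4 : (4 : ℝ) * K.A ≠ 0 := mul_ne_zero four_ne_zero hA'
  exact (mul_eq_zero.1 hk).resolve_left h4

/-- Auxiliary step `pxy_hix`. [bookkeeping] -/
theorem _root_.Summit.KontsevichZagierPeriods.RootDecompWalshStrata.ConicDescent.Conic.pxy_hix (K : Conic) (hA : K.A ≠ 0) {x : ℝ} (hD : 0 ≤ K.Dx x) :
    K.pxy x (K.hix x) = 0 := by
  have hA' : (K.A : ℝ) ≠ 0 := by exact_mod_cast hA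
  have hk := K.key x (K.hix x)
  have h2 : 2 * (K.A : ℝ) * K.hix x + K.Bx x = -√(K.Dx x) := by
    rw [Conic.hix]; field_simp; ring
  rw [h2, neg_sq, Real.sq_sqrt hD, sub_self] at hk
  have h4 : (4 : ℝ) * K.A ≠ 0 := mul_ne_zero four_ne_zero hA'
  exact (mul_eq_zero.1 hk).resolve_left h4

/-- `B′ = b₁`. [calculus] -/
theorem _root_.Summit.KontsevichZagierPeriods.RootDecompWalshStrata.ConicDescent.Conic.hasDerivAt_Bx (K : Conic) (x : ℝ) : HasDerivAt K.Bx K.b1 x :=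
  (((hasDerivAt_id x).const_mul (K.b1 : ℝ)).const_add (K.b0 : ℝ)).congr_deriv (by ring)

/-- `D′ = 2 e x + f`. [calculus] -/
theorem _root_.Summit.KontsevichZagierPeriods.RootDecompWalshStrata.ConicDescent.Conic.hasDerivAt_Dx (K : Conic) (x : ℝ) :
    HasDerivAt K.Dx (2 * K.e * x + K.f) x := by
  have hfun : K.Dx = fun s => (K.e : ℝ) * s ^ 2 + K.f * s + K.g := funext K.Dx_eq
  rw [hfun]
  have h := ((((hasDerivAt_pow 2 x).const_mul (K.e : ℝ)).add
    ((hasDerivAt_id x).const_mul (K.f : ℝ))).add_const (K.g : ℝ))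
  refine h.congr_deriv ?_
  simp only [Nat.cast_ofNat, Nat.add_one_sub_one, pow_one, mul_one]
  ring

/-- The derivative of the root `(−B + √D)/(2A)` where `D > 0`. [calculus] -/
theorem _root_.Summit.KontsevichZagierPeriods.RootDecompWalshStrata.ConicDescent.Conic.hasDerivAt_lox (K : Conic) {x : ℝ} (hD : 0 < K.Dx x) :
    HasDerivAt K.lox ((-(K.b1 : ℝ) + (2 * K.e * x + K.f) / (2 * √(K.Dx x))) / (2 * K.A)) x := by
  have h := ((K.hasDerivAt_Bx x).neg.add ((K.hasDerivAt_Dx x).sqrt hD.ne')).div_const (2 * (K.A : ℝ))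
  exact h

/-- The derivative of the root `(−B − √D)/(2A)` where `D > 0`. [calculus] -/
theorem _root_.Summit.KontsevichZagierPeriods.RootDecompWalshStrata.ConicDescent.Conic.hasDerivAt_hix (K : Conic) {x : ℝ} (hD : 0 < K.Dx x) :
    HasDerivAt K.hix ((-(K.b1 : ℝ) - (2 * K.e * x + K.f) / (2 * √(K.Dx x))) / (2 * K.A)) x := by
  have h := ((K.hasDerivAt_Bx x).neg.sub ((K.hasDerivAt_Dx x).sqrt hD.ne')).div_const (2 * (K.A : ℝ))
  exact h

end Summit.KontsevichZagierPeriods.RootDecompWalshStrata.ConicDescent.BallCube
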